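import Mathlib

/-!
# Federbush, *A phase cell approach to Yang–Mills theory* III, §5.4 «Simple Lattice Geometry»: A) the Theorem on
# Minimum Area (due to A. Blass) and B) Radial Maximal Trees (Radial Properties 1–3 and the existence asserted by the
# construction) — TYPED STATEMENTS with citation tags

statement-level skeleton of published theorems with citation tags; proofs where landed; nothing here is a claim about the Yang–Mills mass gap

Cell `lit-balaban`, reader/typer block **r17 = Federbush**; SKELETON rows `F3-TMA`, `F3-RT` of
`run/shared/lean/pub/lit-balaban/lit-balaban-r17/SKELETON-r17.md`.

**Source.** P. Federbush, CMP **110** (1987) 293–309 [bib `Federbush1987PhaseCellIII`], §5.4 pp. 306–308 (READ AS IMAGES: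
this seat's renders `renders/fedIII/fed1987-cmp110-III-p014|p015-x2.png` of the Project-Euclid scan `run/shared/lean/pub/pub-
balaban/t4/b2b-balaban-t4-lit2/pdf/fed1987-cmp110-III.pdf`; p. 308 from the OCR text `…/texts/fed1987-cmp110-III/p016.txt`).
The abstract: «Incidental to the estimates of this paper we establish some results on "lattice geometry," interesting in
their own right. A bound on the "minimum area" of a loop of length l, in d dimensions, is obtained as (l²/8)(1 − 1/d).
This, a best possible bound, was obtained for us by A. Blass. We also construct a "radial" maximal tree for the lattice in
d dimensions.»  Both are used in §5.3 (proof of Local Stability Theorem 4.2) and the Appendix.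

**A) verbatim (p. 306).** «We first consider the problem of bounding the number of elementary homotopies it takes to
contract a closed contour of l bonds in d dimensions in a complete unit lattice. We will not count as a step removing a
portion of the contour consisting of the same bond traversed in both directions in sequence. … The minimum number of
elementary homotopies it requires to contract a loop to a point is sometimes called the minimum area of the loop.
**Theorem on Minimum Area (due to A. Blass).** In d dimensions the minimum area of a loop of length l is ≤ (l²/8)(1 − 1/d).
Proof. We convert the problem to one of the study of words in a free group. We consider the free group generated by
g₁, …, g_d (and g₁⁻¹, …, g_d⁻¹). Associating g_i to any edge in the i-th direction with positive orientation, and g_i⁻¹ to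
these edges with negative orientation; there is a natural assignment to a loop of length l, of a word of length l (which
we note contains equal numbers of elements g_i and g_i⁻¹). We wish to convert this word to the identity element (or zero
word). In this conversion we allow three kinds of steps: a) removal of adjacent elements of form g_ig_i⁻¹ or g_i⁻¹g_i,
b) interchanging adjacent elements, c) replacing word w₁w₂ by w₂w₁. … Step b) corresponds to an elementary homotopy. In a
sequence of steps converting our word to the identity, we count the number of steps of type b). The minimum number of such
steps in a sequence "contracting" the word to the identity is the "minimum area" of the associated loop.»  «the worst
cases … are of the form g₁^r g₂^r ⋯ g_d^r (g₁⁻¹)^r (g₂⁻¹)^r ⋯ (g_d⁻¹)^r. This, a word of length (2dr) = l, is easily seen to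
require r[(d − 1)r + (d − 2)r + … + r] = (l²/8)(1 − 1/d) steps of type b) to contract. For a bound of the form c(d)l², we
have found the best constant c(d) = (1/8)(1 − 1/d).»

**How A) is typed.**  EXACTLY the printed word calculus: letters `Fin d × Bool` (`(i, true) = g_i`, `(i, false) = g_i⁻¹`),
the three steps as a cost-labelled rewriting relation `Step` (a) and c) cost 0, b) cost 1), its reflexive–transitive
closure with added costs `Reaches`, a «loop» = a word with equal numbers of `g_i` and `g_i⁻¹` for every `i`
(`IsClosedWord`), and the theorem as the closed statement `BlassMinimumAreaTheorem` (a named fact; proof «left to the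
reader» / Blass — Phase 2).  The lower-bound/optimality sentence is typed separately (`BlassWorstCase`).

**B) verbatim (p. 307).** «Properties of Radial Maximal Trees in Z^d. For a point p in Z^d, we write |p| for the distance to
the origin, and d_T(p) for the distance to the origin along T, a maximal tree. The following properties define the term
"radial" applied to T. Radial Property 1. There is a c_a such that for all p, d_T(p) ≤ c_a|p|. Radial Property 2. There is
a c_b such that for each point p, the portion of the tree joining p to the origin (a path from the origin to p, lying in
T) lies within a ball about the origin of radius, |p| + c_b. Radial Property 3. For each c₀ > 1 there is a m(c₀) such that
for each r > 0 one has that: if T is cut at any point p with |p| ≥ r, then the number of vertices lying in a ball of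
radius c₀r about the origin and disconnected from the origin is ≤ mr.»  followed by «Construction of a Radial Maximal
Tree. We construct our tree by an inductive process …» (pp. 307–308), concluding «one may see the resulting tree satisfies
the three Radial Properties.»

**How B) is typed.**  The lattice `ℤ^d = Fin d → ℤ` with the nearest-neighbour graph `latticeGraph d` (Mathlib
`SimpleGraph`); a maximal (= spanning) tree is a subgraph `T ≤ latticeGraph d` with `T.IsTree`; `d_T(p) = T.dist 0 p`;
`|p|` the Euclidean norm; in a tree «the portion of the tree joining p to the origin» = the vertices `q` with
`d_T(0,q) + d_T(q,p) = d_T(0,p)`, and «disconnected from the origin when T is cut at p» = `q ≠ p` on whose path from `0`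
the vertex `p` lies.  The construction's conclusion is the closed statement `RadialTreeExists` (named fact, Phase 2).
-/

namespace Literature.MathematicalPhysics.QuantumFieldTheory.Federbush1986

noncomputable section

open scoped BigOperators

/-! ## A) Minimum area of a loop (A. Blass) -/

namespace MinimumArea

variable {d : ℕ}

/-- Letters of the free group on `g₁, …, g_d`: `(i, true) = g_i`, `(i, false) = g_i⁻¹`; a word is a `List` of letters
(«a natural assignment to a loop of length l, of a word of length l»). [cite: Federbush1987PhaseCellIII, §5.4 A) p. 306] -/
abbrev Letter (d : ℕ) := Fin d × Bool

/-- One step of the printed calculus with its COST (number of elementary homotopies): «a) removal of adjacent elements of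
form g_ig_i⁻¹ or g_i⁻¹g_i» (cost 0), «b) interchanging adjacent elements» (cost 1 — «Step b) corresponds to an elementary
homotopy»), «c) replacing word w₁w₂ by w₂w₁» (cost 0). [cite: Federbush1987PhaseCellIII, §5.4 A) steps a)–c) p. 306] -/
inductive Step : List (Letter d) → List (Letter d) → ℕ → Prop
  | cancel (u v : List (Letter d)) (i : Fin d) (b : Bool) :
      Step (u ++ (i, b) :: (i, !b) :: v) (u ++ v) 0
  | swap (u v : List (Letter d)) (x y : Letter d) :
      Step (u ++ x :: y :: v) (u ++ y :: x :: v) 1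
  | rotate (w₁ w₂ : List (Letter d)) : Step (w₁ ++ w₂) (w₂ ++ w₁) 0

/-- Sequences of steps, with the total number of type-b) steps («In a sequence of steps converting our word to the
identity, we count the number of steps of type b)»). [cite: Federbush1987PhaseCellIII, §5.4 A) p. 306] -/
inductive Reaches : List (Letter d) → List (Letter d) → ℕ → Prop
  | refl (w : List (Letter d)) : Reaches w w 0
  | tail {w w' w'' : List (Letter d)} {k c : ℕ} : Reaches w w' k → Step w' w'' c → Reaches w w'' (k + c)

/-- «The minimum number of such steps in a sequence "contracting" the word to the identity is the "minimum area" of the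
associated loop» — as the predicate «minimum area ≤ k» (some contracting sequence with at most `k` type-b) steps).
[cite: Federbush1987PhaseCellIII, §5.4 A) p. 306] -/
def MinAreaLE (w : List (Letter d)) (k : ℕ) : Prop := ∃ k' ≤ k, Reaches w [] k'

/-- A word comes from a closed lattice loop iff it «contains equal numbers of elements g_i and g_i⁻¹» for every direction
`i`. [cite: Federbush1987PhaseCellIII, §5.4 A) p. 306] -/
def IsClosedWord (w : List (Letter d)) : Prop := ∀ i : Fin d, w.count (i, true) = w.count (i, false)

/-- **Theorem on Minimum Area (due to A. Blass).** «In d dimensions the minimum area of a loop of length l is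
≤ (l²/8)(1 − 1/d).» — for every closed word of length `l` over `d` generators. (Named fact; proof: reduction to the worst
case below, «We leave to the reader the elementary (but non-trivial) argument».) [cite: Federbush1987PhaseCellIII,
Theorem on Minimum Area §5.4 A) p. 306] -/
def BlassMinimumAreaTheorem : Prop :=
  ∀ (d : ℕ) (w : List (Letter d)), IsClosedWord w →
    ∃ k : ℕ, Reaches w [] k ∧ (k : ℝ) ≤ (w.length : ℝ) ^ 2 / 8 * (1 - 1 / (d : ℝ))

/-- The worst-case word «g₁^r g₂^r ⋯ g_d^r (g₁⁻¹)^r (g₂⁻¹)^r ⋯ (g_d⁻¹)^r», «a word of length (2dr) = l».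
[cite: Federbush1987PhaseCellIII, §5.4 A) p. 306] -/
def worstWord (d r : ℕ) : List (Letter d) :=
  ((List.finRange d).flatMap fun i => List.replicate r (i, true)) ++
    ((List.finRange d).flatMap fun i => List.replicate r (i, false))

/-- Optimality as printed: the worst-case word «is easily seen to require r[(d − 1)r + (d − 2)r + … + r] = (l²/8)(1 − 1/d)
steps of type b) to contract. For a bound of the form c(d)l², we have found the best constant c(d) = (1/8)(1 − 1/d).» —
i.e. no contracting sequence of `worstWord d r` has fewer than `r·(r(d−1)d/2) = r²d(d−1)/2` type-b) steps.
[cite: Federbush1987PhaseCellIII, §5.4 A) p. 306] -/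
def BlassWorstCase : Prop :=
  ∀ (d r k : ℕ), Reaches (worstWord d r) [] k → r ^ 2 * (d * (d - 1) / 2) ≤ k

/-- Bookkeeping (proved): the worst-case word has length `2dr`. [cite: Federbush1987PhaseCellIII, §5.4 A) p. 306] -/
theorem length_worstWord (d r : ℕ) : (worstWord d r).length = 2 * d * r := by
  simp [worstWord, List.length_flatMap, List.length_replicate, List.map_const', List.sum_replicate]
  ring

/-- Bookkeeping (proved): for the worst case `l = 2dr`, print's count equals the bound: `r²·d(d−1)/2 = (l²/8)(1 − 1/d)`
(as real numbers, `d ≥ 1`). [cite: Federbush1987PhaseCellIII, §5.4 A) p. 306] -/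
theorem worstCase_count_eq_bound (d r : ℕ) (hd : 1 ≤ d) :
    (r : ℝ) ^ 2 * ((d : ℝ) * ((d : ℝ) - 1) / 2) = ((2 * d * r : ℕ) : ℝ) ^ 2 / 8 * (1 - 1 / (d : ℝ)) := by
  have hd' : (d : ℝ) ≠ 0 := by exact_mod_cast (Nat.one_le_iff_ne_zero.mp hd)
  push_cast
  field_simp
  ring

end MinimumArea

/-! ## B) Radial maximal trees in `ℤ^d` -/

namespace RadialTree

/-- The unit lattice `ℤ^d` with its nearest-neighbour graph: `p ~ q` iff `Σ_i |p_i − q_i| = 1`.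
[cite: Federbush1987PhaseCellIII, §5.4 B) p. 307] -/
def latticeGraph (d : ℕ) : SimpleGraph (Fin d → ℤ) :=
  SimpleGraph.fromRel fun p q => ∑ i, |p i - q i| = 1

/-- «we write |p| for the distance to the origin» (Euclidean). [cite: Federbush1987PhaseCellIII, §5.4 B) p. 307] -/
def enorm {d : ℕ} (p : Fin d → ℤ) : ℝ := Real.sqrt (∑ i, ((p i : ℝ)) ^ 2)

/-- A maximal (spanning) tree of the lattice: a subgraph of `latticeGraph d` on all of `ℤ^d` which is a tree.
[cite: Federbush1987PhaseCellIII, §5.4 B) p. 307] -/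
def IsMaximalTree {d : ℕ} (T : SimpleGraph (Fin d → ℤ)) : Prop := T ≤ latticeGraph d ∧ T.IsTree

/-- «d_T(p) … the distance to the origin along T». [cite: Federbush1987PhaseCellIII, §5.4 B) p. 307] -/
def treeDist {d : ℕ} (T : SimpleGraph (Fin d → ℤ)) (p : Fin d → ℤ) : ℕ := T.dist 0 p

/-- In a tree, «the portion of the tree joining p to the origin (a path from the origin to p, lying in T)» consists of the
vertices `q` with `d_T(0, q) + d_T(q, p) = d_T(0, p)`. [cite: Federbush1987PhaseCellIII, Radial Property 2 p. 307] -/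
def OnPathToOrigin {d : ℕ} (T : SimpleGraph (Fin d → ℤ)) (p q : Fin d → ℤ) : Prop :=
  T.dist 0 q + T.dist q p = T.dist 0 p

/-- **Radial Property 1.** «There is a c_a such that for all p, d_T(p) ≤ c_a|p|.» [cite: Federbush1987PhaseCellIII, Radial
Property 1 p. 307] -/
def RadialProperty1 {d : ℕ} (T : SimpleGraph (Fin d → ℤ)) : Prop :=
  ∃ c_a : ℝ, ∀ p, (treeDist T p : ℝ) ≤ c_a * enorm p

/-- **Radial Property 2.** «There is a c_b such that for each point p, the portion of the tree joining p to the origin … lies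
within a ball about the origin of radius, |p| + c_b.» [cite: Federbush1987PhaseCellIII, Radial Property 2 p. 307] -/
def RadialProperty2 {d : ℕ} (T : SimpleGraph (Fin d → ℤ)) : Prop :=
  ∃ c_b : ℝ, ∀ p q, OnPathToOrigin T p q → enorm q ≤ enorm p + c_b

/-- **Radial Property 3.** «For each c₀ > 1 there is a m(c₀) such that for each r > 0 one has that: if T is cut at any point
p with |p| ≥ r, then the number of vertices lying in a ball of radius c₀r about the origin and disconnected from the origin
is ≤ mr.» (in a tree, `q` is disconnected from `0` by removing `p` iff `q ≠ p` and `p` lies on the path from `0` to `q`).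
[cite: Federbush1987PhaseCellIII, Radial Property 3 p. 307] -/
def RadialProperty3 {d : ℕ} (T : SimpleGraph (Fin d → ℤ)) : Prop :=
  ∀ c₀ : ℝ, 1 < c₀ → ∃ m : ℝ, ∀ r : ℝ, 0 < r → ∀ p : Fin d → ℤ, r ≤ enorm p →
    ({q : Fin d → ℤ | q ≠ p ∧ OnPathToOrigin T q p ∧ enorm q ≤ c₀ * r}.ncard : ℝ) ≤ m * r

/-- «The following properties define the term "radial" applied to T.» [cite: Federbush1987PhaseCellIII, §5.4 B) p. 307] -/
def IsRadial {d : ℕ} (T : SimpleGraph (Fin d → ℤ)) : Prop :=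
  RadialProperty1 T ∧ RadialProperty2 T ∧ RadialProperty3 T

/-- **Existence of a radial maximal tree** («We then construct a maximal tree on the lattice Z^d, radial about the origin,
i.e. satisfying all the properties listed», p. 307; construction pp. 307–308: T₁ ⊂ T₂ ⊂ …, T_i maximal on the ball of
radius 2^i, constants c₁ > 2√d, c₂ > 3c₁, c₃ > 3c₂, radial shortest paths expanded to disjoint trees; «living with it for a
while one may see the resulting tree satisfies the three Radial Properties», p. 308).  Named fact (Phase 2), every
`d ≥ 1`. [cite: Federbush1987PhaseCellIII, §5.4 B) Construction pp. 307–308] -/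
def RadialTreeExists : Prop :=
  ∀ d : ℕ, 1 ≤ d → ∃ T : SimpleGraph (Fin d → ℤ), IsMaximalTree T ∧ IsRadial T

end RadialTree

end

end Literature.MathematicalPhysics.QuantumFieldTheory.Federbush1986
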